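import Mathlib.Data.Real.Basic
import Mathlib.Tactic.Linarith
import Mathlib.Tactic.Ring
import Mathlib.Tactic.Positivity
import Mathlib.Tactic.FieldSimp
import HarnessLib

/-!
# The two-sided cluster bound (TCB) implies the target–target chord inequality for `E₃` (algebraic core)

Support file for the Sahi programme (`--supports stmt-CriticalPhenomena-4575`, prover prim-nh-lead-4575 lead gen 125).
No definitions, no named facts, no sorries; standard axioms; pure real arithmetic.  Memo
`run/shared/lean/prim/prim-sahi/FROM-prim-nh-lead-4575-g125-TCB-EPSCORNER.md`.

SETTING (paper level; the probabilistic identifications are exact-arithmetic checked in the lead's `lab-gen125/eps`, not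
formalised here).  Rooted weighted graph, root `s`, targets `a, b, c`; `A = {s↔a}`, `B = {s↔b}`, `C = {s↔c}`; cells of the
connection-pattern law of `{s,a,b,c}`:
`u = P(B ∧ ¬A)`, `v = P(A ∧ ¬B)`, `x₂ = P(A ∧ C ∧ ¬B)`, `y₂ = P(B ∧ C ∧ ¬A)`, `x₃ = P(A ∧ ¬B ∧ c↔b)`, `y₃ = P(B ∧ ¬A ∧ c↔a)`,
`g = x₃ + y₃` (the pivotality of the pair `ab` for `C`), `pab = P(A ∧ B)`, `M = P(A ∪ B) = pab + u + v ≤ 1`, `pc = P(C)`.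
Along the target–target pair `e = {a,b}` the slopes of the increasing-star pencil are `δ_a = u`, `δ_b = v`, `δ_c = g`,
`δ_ab = u + v`, `δ_ac = g + y₂`, `δ_bc = g + x₂`, and `m_a(0) = pab + v`, `m_b(0) = pab + u`, `m_c(0) = pc`, so the worst chord
bracket `CH₂ = Σ_cyc δ_aδ_bc − [Σ_cyc m_a(0)δ_bδ_c + 2δ_aδ_bδ_c]` of `…IncStarPencilChord` takes the TARGET–TARGET FORM
`CH₂ = g(u+v)(2 − M) + u·x₂ + v·y₂ − pc·u·v` (`ttChord_form`; TT-CHORD for `E₃` ⟺ `CH₂ ≥ 0`).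

THE TWO-SIDED CLUSTER BOUND (conjecture TCB, lead gen 125):
`P(c ∈ K_s ∪ K_b | A ∧ ¬B) + P(c ∈ K_s ∪ K_a | B ∧ ¬A) ≥ P(c ↔ s)`, i.e. `(x₂+x₃)/v + (y₂+y₃)/u ≥ pc`, i.e. (cleared)
`u(x₂+x₃) + v(y₂+y₃) ≥ pc·u·v`.  This file kernel-checks `CH₂ ≥ u(x₂+x₃) + v(y₂+y₃) − pc·u·v` (`ttChord_ge_twoSidedCluster`),
hence TCB ⟹ TT-CHORD for `E₃` along every target–target pair (`ttChord_nonneg_of_TCB`, `ttChord_nonneg_of_TCB_cond`).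
-/

namespace Summit.CriticalPhenomena.PercolationContinuityZ3.Theorems

namespace IncStar

/-- **Target–target form of the `E₃` chord bracket.**  With the slope identifications of the header
(`δ_a = u`, `δ_b = v`, `δ_c = g`, `δ_ab = u+v`, `δ_ac = g+y₂`, `δ_bc = g+x₂`, `m_a = pab+v`, `m_b = pab+u`, `m_c = pc`) the worst
chord bracket `CH₂ = Σ_cyc δ_aδ_bc − [Σ_cyc m_aδ_bδ_c + 2δ_aδ_bδ_c]` equals `g(u+v)(2 − M) + u x₂ + v y₂ − pc·u·v`, `M = pab+u+v`.
[this work] -/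
theorem ttChord_form (pab pc u v g x2 y2 : ℝ) :
    (u * (g + x2) + v * (g + y2) + g * (u + v)) - (((pab + v) * v * g + (pab + u) * u * g + pc * u * v) + 2 * (u * v * g))
      = g * (u + v) * (2 - (pab + u + v)) + u * x2 + v * y2 - pc * u * v := by
  ring

/-- **The TT chord bracket dominates the two-sided cluster form.**  For nonnegative cells with `g = x₃ + y₃` and `M ≤ 1`,
`g(u+v)(2 − M) + u x₂ + v y₂ − pc·u·v ≥ u(x₂ + x₃) + v(y₂ + y₃) − pc·u·v`
(the difference is `x₃[(u+v)(2−M) − u] + y₃[(u+v)(2−M) − v] ≥ x₃ v + y₃ u ≥ 0`). [this work] -/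
theorem ttChord_ge_twoSidedCluster (M pc u v x2 y2 x3 y3 : ℝ) (hM : M ≤ 1)
    (hu : 0 ≤ u) (hv : 0 ≤ v) (hx3 : 0 ≤ x3) (hy3 : 0 ≤ y3) :
    u * (x2 + x3) + v * (y2 + y3) - pc * u * v
      ≤ (x3 + y3) * (u + v) * (2 - M) + u * x2 + v * y2 - pc * u * v := by
  nlinarith [mul_nonneg hx3 hu, mul_nonneg hx3 hv, mul_nonneg hy3 hu, mul_nonneg hy3 hv,
    mul_nonneg (mul_nonneg hx3 (add_nonneg hu hv)) (by linarith : (0:ℝ) ≤ 1 - M),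
    mul_nonneg (mul_nonneg hy3 (add_nonneg hu hv)) (by linarith : (0:ℝ) ≤ 1 - M)]

/-- **TCB ⟹ TT-CHORD (product form).**  If the two-sided cluster bound holds in its cleared form
`pc·u·v ≤ u(x₂+x₃) + v(y₂+y₃)`, then the target–target chord bracket of `E₃` is nonnegative. [this work] -/
theorem ttChord_nonneg_of_TCB (M pc u v x2 y2 x3 y3 : ℝ) (hM : M ≤ 1)
    (hu : 0 ≤ u) (hv : 0 ≤ v) (hx3 : 0 ≤ x3) (hy3 : 0 ≤ y3)
    (hTCB : pc * u * v ≤ u * (x2 + x3) + v * (y2 + y3)) :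
    0 ≤ (x3 + y3) * (u + v) * (2 - M) + u * x2 + v * y2 - pc * u * v := by
  have h := ttChord_ge_twoSidedCluster M pc u v x2 y2 x3 y3 hM hu hv hx3 hy3
  linarith

/-- **TCB ⟹ TT-CHORD (conditional-probability form).**  If `u, v > 0` and
`P(c ∈ K_s ∪ K_b | A¬B) + P(c ∈ K_s ∪ K_a | ¬AB) ≥ P(C)`, read as `(x₂+x₃)/v + (y₂+y₃)/u ≥ pc`, then the target–target chord
bracket of `E₃` is nonnegative.  (When `u = 0` or `v = 0` the bracket is `≥ 0` trivially: `ttChord_nonneg_of_degenerate`.)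
[this work] -/
theorem ttChord_nonneg_of_TCB_cond (M pc u v x2 y2 x3 y3 : ℝ) (hM : M ≤ 1)
    (hu : 0 < u) (hv : 0 < v) (hx3 : 0 ≤ x3) (hy3 : 0 ≤ y3)
    (hTCB : pc ≤ (x2 + x3) / v + (y2 + y3) / u) :
    0 ≤ (x3 + y3) * (u + v) * (2 - M) + u * x2 + v * y2 - pc * u * v := by
  have huv : 0 < u * v := mul_pos hu hv
  have hprod : pc * u * v ≤ u * (x2 + x3) + v * (y2 + y3) := by
    have h1 : pc * (u * v) ≤ ((x2 + x3) / v + (y2 + y3) / u) * (u * v) :=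
      mul_le_mul_of_nonneg_right hTCB (le_of_lt huv)
    have h2 : ((x2 + x3) / v + (y2 + y3) / u) * (u * v) = u * (x2 + x3) + v * (y2 + y3) := by
      field_simp
    calc pc * u * v = pc * (u * v) := by ring
      _ ≤ ((x2 + x3) / v + (y2 + y3) / u) * (u * v) := h1
      _ = u * (x2 + x3) + v * (y2 + y3) := h2
  exact ttChord_nonneg_of_TCB M pc u v x2 y2 x3 y3 hM (le_of_lt hu) (le_of_lt hv) hx3 hy3 hprod

/-- **Degenerate endpoints.**  If `u = 0` or `v = 0` (one of the targets is rooted whenever the other is) and `x₂, y₂ ≥ 0`,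
the target–target chord bracket is nonnegative with no hypothesis. [this work] -/
theorem ttChord_nonneg_of_degenerate (M pc u v x2 y2 x3 y3 : ℝ) (hM : M ≤ 1)
    (hu : 0 ≤ u) (hv : 0 ≤ v) (hx2 : 0 ≤ x2) (hy2 : 0 ≤ y2) (hx3 : 0 ≤ x3) (hy3 : 0 ≤ y3) (huv : u * v = 0) :
    0 ≤ (x3 + y3) * (u + v) * (2 - M) + u * x2 + v * y2 - pc * u * v := by
  have h0 : pc * u * v = 0 := by rw [mul_assoc, huv, mul_zero]
  rw [h0]
  have h2M : 0 ≤ 2 - M := by linarith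
  nlinarith [mul_nonneg (mul_nonneg (add_nonneg hx3 hy3) (add_nonneg hu hv)) h2M, mul_nonneg hu hx2, mul_nonneg hv hy2]

end IncStar

end Summit.CriticalPhenomena.PercolationContinuityZ3.Theorems
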